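import Mathlib
import Literature.NumberTheory.LFunctions.AFECoefficient
import HarnessLib

/-!
# Sharp-ended eta vector at the zeros, VI: the alternating partial sum at a zero
# (route EtaLeadingQuarter, item `EtaLeadingSecondMoment`, stmt-RiemannHypothesis-21791)

The sharp-ended eta vector of length `M = 2L`, `A(2L; s) = ∑_{m ≤ 2L} (−1)^m m^{-s}`, is the
combination `2^{1-s} P(L) − P(2L)` of plain partial sums `P(X) = ∑_{m ≤ X} m^{-s}`
(`altSum_eq_two_cpow_mul_sub`). With `Q(X) = ζ(s) − P(X) + X^{1-s}/(1-s) − afeCoeff(s) D(X)`,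
`D(X) = ∑_{ν ≤ [t/(2πX)]} ν^{s-1}` (the quantity bounded in parts IV–V), the main terms
`X^{1-s}/(1-s)` cancel exactly (`2^{1-s} L^{1-s} = (2L)^{1-s}` — the eta function has no pole) and
the even dual frequencies cancel exactly (`2^{1-s}(2j)^{s-1} = j^{s-1}`), leaving

`A(2L; s) = (2^{1-s} − 1) ζ(s) − afeCoeff(s) 2^{1-s} ∑_{ν ≤ [t/(2πL)], ν odd} ν^{s-1} − 2^{1-s} Q(L) + Q(2L)`

(`altSum_identity`). At a zero `s = 1/2 + it` of `ζ` this gives the duality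
`‖A(2L; s)‖ ≤ √2 ‖∑_{ν odd ≤ [t/(2πL)]} ν^{s-1}‖ + √2‖Q(L)‖ + ‖Q(2L)‖` (`norm_altSum_le_of_zero`):
the stationary (dual) terms have moduli `√(2/ν)`, `ν` odd — the source of the constant `1/4` in
`EtaLeadingSecondMoment` (BRIEF-L18-K1 §1).

No hypothesis on the real part of the zero is used here; RH enters only when the consumer
identifies the ordinates. Nothing here bears on the truth of RH.
-/

noncomputable section

open Complex MeasureTheory Set Filter intervalIntegral Finset
open scoped Real Topology Interval

set_option linter.dupNamespace false  -- the mandated namespace repeats `RiemannHypothesis`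

namespace Summit.RiemannHypothesis.RiemannHypothesis.Theorems.EtaLeadingQuarter.SecondMomentAFE

open Literature.NumberTheory.LFunctions Literature.NumberTheory.LFunctions.AFE

/-! ## Even/odd bookkeeping -/

/-- `(2j)^w = 2^w j^w` for natural `j` (casts of nonnegative reals). [folklore] -/
theorem natCast_two_mul_cpow (j : ℕ) (w : ℂ) :
    ((2 * j : ℕ) : ℂ) ^ w = (2 : ℂ) ^ w * (j : ℂ) ^ w := by
  have h := Complex.mul_cpow_ofReal_nonneg (by norm_num : (0 : ℝ) ≤ 2) (Nat.cast_nonneg j) w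
  push_cast at h ⊢
  exact h

/-- The sum over the even integers in `[1, K]` is the sum over `2j`, `j ∈ [1, K/2]`. [folklore] -/
theorem sum_filter_even_eq (K : ℕ) (g : ℕ → ℂ) :
    ∑ m ∈ (Finset.Icc 1 K).filter (fun m => Even m), g m
      = ∑ j ∈ Finset.Icc 1 (K / 2), g (2 * j) := by
  symm
  apply Finset.sum_nbij' (fun j => 2 * j) (fun m => m / 2)
  · intro j hj
    simp only [Finset.mem_Icc] at hj
    simp only [Finset.mem_filter, Finset.mem_Icc]
    exact ⟨⟨by omega, by omega⟩, even_two_mul j⟩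
  · intro m hm
    simp only [Finset.mem_filter, Finset.mem_Icc] at hm
    simp only [Finset.mem_Icc]
    obtain ⟨⟨h1, h2⟩, ⟨k, hk⟩⟩ := hm
    omega
  · intro j hj; simp
  · intro m hm
    simp only [Finset.mem_filter, Finset.mem_Icc] at hm
    obtain ⟨-, ⟨k, hk⟩⟩ := hm
    omega
  · intro j hj; rfl

/-- A sum over `[1, K]` splits into its odd and even parts. [folklore] -/
theorem sum_Icc_eq_odd_add_even (K : ℕ) (g : ℕ → ℂ) :
    ∑ m ∈ Finset.Icc 1 K, g m
      = ∑ m ∈ (Finset.Icc 1 K).filter (fun m => Odd m), g m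
        + ∑ m ∈ (Finset.Icc 1 K).filter (fun m => Even m), g m := by
  rw [← Finset.sum_filter_add_sum_filter_not (Finset.Icc 1 K) (fun m => Odd m)]
  congr 1
  apply Finset.sum_congr _ (fun _ _ => rfl)
  ext m
  simp only [Finset.mem_filter, Nat.not_odd_iff_even]

/-- **The alternating partial sum as a combination of plain partial sums**:
`∑_{m ≤ 2L} (−1)^m m^{-s} = 2^{1-s} ∑_{j ≤ L} j^{-s} − ∑_{m ≤ 2L} m^{-s}`. [folklore] -/
theorem altSum_eq_two_cpow_mul_sub (L : ℕ) (s : ℂ) :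
    ∑ m ∈ Finset.Icc 1 (2 * L), (-1 : ℂ) ^ m * (m : ℂ) ^ (-s)
      = (2 : ℂ) ^ (1 - s) * ∑ j ∈ Finset.Icc 1 L, (j : ℂ) ^ (-s)
        - ∑ m ∈ Finset.Icc 1 (2 * L), (m : ℂ) ^ (-s) := by
  have h2 : (2 : ℂ) ≠ 0 := two_ne_zero
  rw [sum_Icc_eq_odd_add_even (2 * L) (fun m => (-1 : ℂ) ^ m * (m : ℂ) ^ (-s)),
    sum_Icc_eq_odd_add_even (2 * L) (fun m => (m : ℂ) ^ (-s))]
  have hodd : ∑ m ∈ (Finset.Icc 1 (2 * L)).filter (fun m => Odd m), (-1 : ℂ) ^ m * (m : ℂ) ^ (-s)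
      = -∑ m ∈ (Finset.Icc 1 (2 * L)).filter (fun m => Odd m), (m : ℂ) ^ (-s) := by
    rw [← Finset.sum_neg_distrib]
    apply Finset.sum_congr rfl
    intro m hm
    rw [(Finset.mem_filter.1 hm).2.neg_one_pow]; ring
  have heven : ∑ m ∈ (Finset.Icc 1 (2 * L)).filter (fun m => Even m), (-1 : ℂ) ^ m * (m : ℂ) ^ (-s)
      = ∑ m ∈ (Finset.Icc 1 (2 * L)).filter (fun m => Even m), (m : ℂ) ^ (-s) := by
    apply Finset.sum_congr rfl
    intro m hm
    rw [(Finset.mem_filter.1 hm).2.neg_one_pow]; ring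
  have heven' : ∑ m ∈ (Finset.Icc 1 (2 * L)).filter (fun m => Even m), (m : ℂ) ^ (-s)
      = (2 : ℂ) ^ (-s) * ∑ j ∈ Finset.Icc 1 L, (j : ℂ) ^ (-s) := by
    rw [sum_filter_even_eq, Nat.mul_div_cancel_left L two_pos, Finset.mul_sum]
    apply Finset.sum_congr rfl
    intro j _
    exact natCast_two_mul_cpow j (-s)
  rw [hodd, heven, heven']
  have e : (2 : ℂ) ^ (1 - s) = 2 * (2 : ℂ) ^ (-s) := by
    rw [show (1 : ℂ) - s = -s + 1 by ring, Complex.cpow_add _ _ h2, Complex.cpow_one]; ring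
  rw [e]
  ring

/-- **The dual sums combine to the odd frequencies**: for `K : ℕ`,
`2^{1-s} ∑_{ν ≤ K} ν^{s-1} − ∑_{ν ≤ K/2} ν^{s-1} = 2^{1-s} ∑_{ν ≤ K, ν odd} ν^{s-1}`
(`2^{1-s} (2j)^{s-1} = j^{s-1}`). [folklore] -/
theorem dualSum_combination (K : ℕ) (s : ℂ) :
    (2 : ℂ) ^ (1 - s) * ∑ ν ∈ Finset.Icc 1 K, (ν : ℂ) ^ (s - 1)
        - ∑ ν ∈ Finset.Icc 1 (K / 2), (ν : ℂ) ^ (s - 1)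
      = (2 : ℂ) ^ (1 - s) * ∑ ν ∈ (Finset.Icc 1 K).filter (fun ν => Odd ν), (ν : ℂ) ^ (s - 1) := by
  have h2 : (2 : ℂ) ≠ 0 := two_ne_zero
  rw [sum_Icc_eq_odd_add_even K (fun ν => (ν : ℂ) ^ (s - 1)), mul_add]
  have heven : (2 : ℂ) ^ (1 - s) * ∑ ν ∈ (Finset.Icc 1 K).filter (fun ν => Even ν), (ν : ℂ) ^ (s - 1)
      = ∑ ν ∈ Finset.Icc 1 (K / 2), (ν : ℂ) ^ (s - 1) := by
    rw [sum_filter_even_eq, Finset.mul_sum]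
    apply Finset.sum_congr rfl
    intro j _
    rw [natCast_two_mul_cpow j (s - 1), ← mul_assoc, ← Complex.cpow_add _ _ h2,
      show (1 : ℂ) - s + (s - 1) = 0 by ring, Complex.cpow_zero, one_mul]
  rw [heven]
  ring

/-- `[t/(2π·2L)] = [t/(2πL)]/2`. [folklore] -/
theorem floor_two_mul_eq (t : ℝ) (L : ℕ) :
    ⌊t / (2 * π * ((2 * L : ℕ) : ℝ))⌋₊ = ⌊t / (2 * π * L)⌋₊ / 2 := by
  rw [← Nat.floor_div_ofNat (t / (2 * π * L)) 2]
  congr 1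
  push_cast
  rw [div_div]
  ring_nf

/-! ## The identity and the duality at a zero -/

/-- **The alternating partial sum through the approximate functional equation.** For every `s`,
`L` and every real `t` used to cut the dual sums, with `K = [t/(2πL)]`:
`∑_{m ≤ 2L} (−1)^m m^{-s} = (2^{1-s} − 1) ζ(s) − afeCoeff(s) 2^{1-s} ∑_{ν ≤ K, ν odd} ν^{s-1}`
`  − 2^{1-s} Q(L) + Q(2L)`, where
`Q(X) = ζ(s) − ∑_{m ≤ X} m^{-s} + X^{1-s}/(1-s) − afeCoeff(s) ∑_{ν ≤ [t/(2πX)]} ν^{s-1}`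
(pure algebra: the main terms and the even dual frequencies cancel). [folklore] -/
theorem altSum_identity (L : ℕ) (s : ℂ) (t : ℝ) :
    ∑ m ∈ Finset.Icc 1 (2 * L), (-1 : ℂ) ^ m * (m : ℂ) ^ (-s)
      = ((2 : ℂ) ^ (1 - s) - 1) * riemannZeta s
        - afeCoeff s * (2 : ℂ) ^ (1 - s)
          * ∑ ν ∈ (Finset.Icc 1 ⌊t / (2 * π * L)⌋₊).filter (fun ν => Odd ν), (ν : ℂ) ^ (s - 1)
        - (2 : ℂ) ^ (1 - s) * (riemannZeta s - ∑ n ∈ Finset.Icc 1 L, (n : ℂ) ^ (-s)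
            + (L : ℂ) ^ (1 - s) / (1 - s)
            - afeCoeff s * ∑ n ∈ Finset.Icc 1 ⌊t / (2 * π * L)⌋₊, (n : ℂ) ^ (s - 1))
        + (riemannZeta s - ∑ n ∈ Finset.Icc 1 (2 * L), (n : ℂ) ^ (-s)
            + ((2 * L : ℕ) : ℂ) ^ (1 - s) / (1 - s)
            - afeCoeff s * ∑ n ∈ Finset.Icc 1 ⌊t / (2 * π * ((2 * L : ℕ) : ℝ))⌋₊,
                (n : ℂ) ^ (s - 1)) := by
  rw [altSum_eq_two_cpow_mul_sub, floor_two_mul_eq, natCast_two_mul_cpow L (1 - s)]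
  have hd := dualSum_combination ⌊t / (2 * π * L)⌋₊ s
  -- isolate the dual sums
  set D1 : ℂ := ∑ ν ∈ Finset.Icc 1 ⌊t / (2 * π * L)⌋₊, (ν : ℂ) ^ (s - 1) with hD1
  set D2 : ℂ := ∑ ν ∈ Finset.Icc 1 (⌊t / (2 * π * L)⌋₊ / 2), (ν : ℂ) ^ (s - 1) with hD2
  set SO : ℂ := ∑ ν ∈ (Finset.Icc 1 ⌊t / (2 * π * L)⌋₊).filter (fun ν => Odd ν),
    (ν : ℂ) ^ (s - 1) with hSO
  have hSO' : afeCoeff s * (2 : ℂ) ^ (1 - s) * SO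
      = afeCoeff s * ((2 : ℂ) ^ (1 - s) * D1) - afeCoeff s * D2 := by
    rw [mul_assoc, ← hd]; ring
  rw [hSO']
  ring

/-- `‖2^{1-s}‖ = √2` on the critical line. [folklore] -/
theorem norm_two_cpow_one_sub {t : ℝ} (s : ℂ) (hs : s = 1 / 2 + t * I) :
    ‖(2 : ℂ) ^ (1 - s)‖ = Real.sqrt 2 := by
  have h := Complex.norm_natCast_cpow_of_pos (n := 2) two_pos (1 - s)
  push_cast at h
  rw [h, hs, Real.sqrt_eq_rpow]
  congr 1
  simp
  norm_num

/-- **Duality at a zero.** If `ζ(s) = 0` with `s = 1/2 + it`, then for every `L`: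
`‖∑_{m ≤ 2L} (−1)^m m^{-s}‖ ≤ √2 ‖∑_{ν ≤ [t/(2πL)], ν odd} ν^{s-1}‖ + √2 ‖Q(L)‖ + ‖Q(2L)‖`
(`|afeCoeff(1/2+it)| ≤ 1`, tree `AFE.norm_afeCoeff_half_le_one`; `|2^{1-s}| = √2`). The real
part of the zero is not used beyond the shape `s = 1/2 + it` of the critical line (under RH every
ordinate of a non-trivial zero gives such an `s`). [folklore] -/
theorem norm_altSum_le_of_zero (L : ℕ) {t : ℝ} (s : ℂ) (hs : s = 1 / 2 + t * I)
    (hzero : riemannZeta s = 0) :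
    ‖∑ m ∈ Finset.Icc 1 (2 * L), (-1 : ℂ) ^ m * (m : ℂ) ^ (-s)‖
      ≤ Real.sqrt 2
          * ‖∑ ν ∈ (Finset.Icc 1 ⌊t / (2 * π * L)⌋₊).filter (fun ν => Odd ν), (ν : ℂ) ^ (s - 1)‖
        + Real.sqrt 2 * ‖riemannZeta s - ∑ n ∈ Finset.Icc 1 L, (n : ℂ) ^ (-s)
            + (L : ℂ) ^ (1 - s) / (1 - s)
            - afeCoeff s * ∑ n ∈ Finset.Icc 1 ⌊t / (2 * π * L)⌋₊, (n : ℂ) ^ (s - 1)‖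
        + ‖riemannZeta s - ∑ n ∈ Finset.Icc 1 (2 * L), (n : ℂ) ^ (-s)
            + ((2 * L : ℕ) : ℂ) ^ (1 - s) / (1 - s)
            - afeCoeff s * ∑ n ∈ Finset.Icc 1 ⌊t / (2 * π * ((2 * L : ℕ) : ℝ))⌋₊,
                (n : ℂ) ^ (s - 1)‖ := by
  rw [altSum_identity L s t]
  set SO : ℂ := ∑ ν ∈ (Finset.Icc 1 ⌊t / (2 * π * L)⌋₊).filter (fun ν => Odd ν),
    (ν : ℂ) ^ (s - 1) with hSO
  set Q1 : ℂ := riemannZeta s - ∑ n ∈ Finset.Icc 1 L, (n : ℂ) ^ (-s)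
    + (L : ℂ) ^ (1 - s) / (1 - s)
    - afeCoeff s * ∑ n ∈ Finset.Icc 1 ⌊t / (2 * π * L)⌋₊, (n : ℂ) ^ (s - 1) with hQ1
  set Q2 : ℂ := riemannZeta s - ∑ n ∈ Finset.Icc 1 (2 * L), (n : ℂ) ^ (-s)
    + ((2 * L : ℕ) : ℂ) ^ (1 - s) / (1 - s)
    - afeCoeff s * ∑ n ∈ Finset.Icc 1 ⌊t / (2 * π * ((2 * L : ℕ) : ℝ))⌋₊, (n : ℂ) ^ (s - 1)
    with hQ2
  have h2 : ‖(2 : ℂ) ^ (1 - s)‖ = Real.sqrt 2 := norm_two_cpow_one_sub s hs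
  have hC : ‖afeCoeff s‖ ≤ 1 := by rw [hs]; exact norm_afeCoeff_half_le_one t
  rw [hzero, mul_zero, zero_sub]
  calc ‖-(afeCoeff s * (2 : ℂ) ^ (1 - s) * SO) - (2 : ℂ) ^ (1 - s) * Q1 + Q2‖
      ≤ ‖-(afeCoeff s * (2 : ℂ) ^ (1 - s) * SO)‖ + ‖(2 : ℂ) ^ (1 - s) * Q1‖ + ‖Q2‖ := by
        refine (norm_add_le _ _).trans ?_
        gcongr
        exact norm_sub_le _ _
    _ = ‖afeCoeff s‖ * Real.sqrt 2 * ‖SO‖ + Real.sqrt 2 * ‖Q1‖ + ‖Q2‖ := by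
        rw [norm_neg, norm_mul, norm_mul, norm_mul, h2]
    _ ≤ 1 * Real.sqrt 2 * ‖SO‖ + Real.sqrt 2 * ‖Q1‖ + ‖Q2‖ := by
        gcongr
    _ = Real.sqrt 2 * ‖SO‖ + Real.sqrt 2 * ‖Q1‖ + ‖Q2‖ := by rw [one_mul]

end Summit.RiemannHypothesis.RiemannHypothesis.Theorems.EtaLeadingQuarter.SecondMomentAFE

end
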